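import Summits.RiemannHypothesis.RiemannHypothesis.Theses.PluckedString

/-!
# Route `PluckedString`, assembly item `Assembly` (stmt-RiemannHypothesis-2626) — CLOSED by name

`Assembly : StringThesis → Summit.RiemannHypothesis`: if `−Ψ` is a Kreĭn screw function on `ℝ` (the kernel
`Ψ(t) + Ψ(u) − Ψ(t − u)` is non-negative on every finite real configuration — the route's target `StringThesis`,
Suzuki 2023 Thm 1.2 face of RH), then the Riemann Hypothesis holds.  This is literally the route's deciding
theorem `Theses.PluckedString.closes` (Suzuki 2023 Thm 1.2 in the real quadratic-form shape,
`Suzuki2023_thm12.iff_real Suzuki2023_thm12_holds`, proved in the tree, + the `Summit ↔ Mathlib` RH bridge), so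
the closer is one line.

LABEL: RH-EQUIVALENCE bookkeeping — `StringThesis` is EQUIVALENT to RH (Suzuki 2023 Thm 1.2; converse in the tree
as `pluckedStringScrewConverse_proof`); closing the assembly binder records the implication, it is NOT progress toward
RH and asserts nothing about `StringThesis`. Nothing here bears on the truth of RH.
-/

-- `Summit.RiemannHypothesis.RiemannHypothesis.…` duplicates `RiemannHypothesis` BY DESIGN (D-0017).
set_option linter.dupNamespace false

namespace Summit.RiemannHypothesis.RiemannHypothesis.Theorems

/-- **`Assembly`** (route `PluckedString`, item stmt-RiemannHypothesis-2626): `StringThesis → RiemannHypothesis`,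
by the route's deciding theorem `Theses.PluckedString.closes` (Suzuki 2023 Thm 1.2, sufficiency, proved in the
tree as `Suzuki2023_thm12_holds`). RH-EQUIVALENCE bookkeeping; nothing asserted about `StringThesis`.
[cite: Suzuki2023, Thm 1.2] -/
theorem pluckedStringAssembly_proof :
    Summit.RiemannHypothesis.RiemannHypothesis.Theses.PluckedString.Assembly :=
  fun hX => Summit.RiemannHypothesis.RiemannHypothesis.Theses.PluckedString.closes hX

end Summit.RiemannHypothesis.RiemannHypothesis.Theorems
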